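/-
Copyright (c) 2026 the pub-hodgecm-mathlib formalisation cell (harness21).  Prover seat hodgecm-mathlib-K2E1-p11 (g4), Track B ∕ K2-LIT, h413 = `stmt-HodgeConjecture-24833`,
R90-TF section S8 «ContSpec-n½», #2 road (G side), S8 dealer R90-CS-plan (g3) S8-R136 (3) ∕ S8-R151 (1) «NON-ZERO SECTION WITNESS AT A LEVEL», FILE 3 (ARCH ROAD (A)) of the census
`R90/S8/CENSUS-ChiSectionPairArchSection.K2E1-p11-g4.md` 3c6bbbb28138e070 — DEFINITIONS: the ARCHIMEDEAN LAST-ROW SECTION `Φa(a) := Θ(x₂)·ρ(a)·χ₂⟨det⟩` on `G_∞ = U(2,1)(L ⊗ ℝ)`, its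
unit phase `⟨c•X · X⁻¹⟩ ∈ U(1)(𝔸)`, its last-row character `Θ` and its real vanishing factor `ρ`; read-backs only (the letters `hΦa*` of ★ p863433 are the THEOREMS files 3a–3c).
-/
import Summits.HodgeConjecture.HodgeConjecture.Theorems.R90S8ChiSectionPairFinLevelSectionU3   -- ★ p863484 (this seat): §0 Borel components + splitting (FILE 2); brings ★ FILE 1, `chiSectionSpacePair`, `archPart`∕`finPart`
import Literature.NumberTheory.Automorphic.UnitaryGroupAdelicDet                              -- ★ `adelicDet` (`det : U(J)(𝔸) →* U(1)(𝔸)`), `adelicOne`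
import Literature.NumberTheory.Automorphic.UnitaryGroupAdelicOneTorusDictionary               -- ★ `adelicOneChar ψ : U(1)(𝔸) →* ℂˣ` (`ψ` read on `adelicOne`)
import Literature.NumberTheory.Automorphic.UnitaryGroupAdelicCharactersDetQuasiSplit          -- ★ `antidiagonal_over_det_ne_zero`
import Literature.NumberTheory.Automorphic.UnitaryGroupGlobalGenericity                       -- ★ `conjAdele_conjAdele` (`c ⊗ 1` is an involution for `c² = 1`)
import HarnessLib

/-!
# S8 #2 road (G side) — `R90S8ChiSectionPairArchSectionU3Defs`: the ARCHIMEDEAN LAST-ROW SECTION of the non-zero `(χ₁, χ₂)`-pair-section witness — definitions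
# `idelePhase X = ⟨(c•X)·X⁻¹⟩ ∈ U(1)(𝔸_{L⁺})`, `lastRowChar χ₁ χ₂ x = χ₁((c•x)⁻¹)·χ₂⟨(c•x)x⁻¹⟩` (units) ∕ `0`, `archLastRow a j = (ι_∞ a)₂ⱼ`, `archRowFactor a = ∏_{w∣∞} ‖(x₂)_w‖∕‖row_w‖`,
# **`archSection χ₁ χ₂ a = lastRowChar (x₂) · archRowFactor a · χ₂⟨det ι_∞ a⟩`**

Track B ∕ K2-LIT, crux h413 = `stmt-HodgeConjecture-24833`, route of record `HCCMUnconditional`; cell `hodgecm-mathlib`, R90-TF programme, section S8 «ContSpec-n½», socket (V)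
`sock_S8_res_midBlock_ne_bot` (`Lines/R90_S8_ResidualSpectrumU3B.lean` :300), discharge-table row (i) «non-zero section witness» (K2E2-p12 (g9) 3df908fcf11ad296).  DEFINITIONS FILE
(`--kind definition --supports stmt-HodgeConjecture-24833 --as helper`): five `def`s + `rfl`∕unfolding read-backs and the one membership lemma the phase needs; no `instance`, no `notation`, no
named-fact hypothesis, no `sorry`.  CLOSES NO SOCKET; pays no letter: it FIXES THE BYTES of the archimedean section `Φa` whose letters `hΦac hΦaB hΦa1` (★ p863433 FILE 1) the theorems
files 3a (multiplier algebra), 3b (continuity), 3c (assembly + THE WITNESS) prove.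

THE MATHEMATICS (census road (A); [BorelJacquet1979, §4.1]; [Rogawski1990, §1.9–§1.10]; [MoeglinWaldspurger1995, I.2.17]).  For `a ∈ G_∞ = U(J₃)(L ⊗ ℝ)` let `M := ι_∞(a) ∈ U(J₃)(𝔸_{L⁺}) ≤
GL₃(𝔸_L)` (finite part `1`) and `x_j := M₂ⱼ` its LAST ROW.  Under left multiplication by an upper-triangular `b` the last row scales, `x ↦ b₂₂·x`, with `c•b₂₂ = b₀₀⁻¹` (unitarity of
`B ≤ U(J₃)`, ★ `conjAdele_diag_mul_diag_rev`) and `det b = b₀₀ b₁₁ b₂₂`.  The unitary character `Θ(x) := χ₁((c•x)⁻¹)·χ₂⟨(c•x)·x⁻¹⟩` of `𝔸_Lˣ` (`⟨Y⟩` = the norm-one idele `Y`, `(c•Y)·Y = 1`, read in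
★ `adelicOne ≃ TorusDict.torus`) therefore satisfies `Θ(b₂₂ x)·χ₂⟨det(bM)⟩ = χ₁(b₀₀)χ₂⟨b₁₁⟩·Θ(x)·χ₂⟨det M⟩` (file 3a), and the real factor `ρ(a) := ∏_{w∣∞} ‖(x₂)_w‖∕‖((x₀)_w,(x₁)_w,(x₂)_w)‖_∞
∈ [0, 1]` is invariant under `x ↦ b₂₂ x`; so `Φa := Θ(x₂)·ρ·χ₂⟨det M⟩` is left-`(χ₁, χ₂)`-equivariant with the ARCHIMEDEAN multiplier `[χ₁χ₂](b_∞)` of ★ p863484 `borelPairChar_eq_arch_mul_fin`,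
`Φa(1) = 1`, and it is CONTINUOUS because `|Θ| = 1` on units (unitary `χ₁, χ₂`) while `ρ → 0` at the boundary `{some (x₂)_w = 0}` (file 3b) — the «unitarity instead of an integral
archimedean type» device of the census (no `HasUnitaryArchType` letter for `μω`).
* D1 `idelePhase X : adelicOne` (`= ⟨(c•X)·X⁻¹⟩`, membership `units_map_conjAdele_mul_inv_mem_adelicOne` from ★ `conjAdele_conjAdele`, `c² = 1` by ★ `IsCMField.orderOf_complexConj`) + `coe_idelePhase`.
* D2 `lastRowChar χ₁ χ₂ x` (+ `lastRowChar_of_isUnit`, `lastRowChar_of_not_isUnit`).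
* D3 `archLastRow a j` (+ `archLastRow_def`), D4 `archRowFactor a` (+ `archRowFactor_def`), D5 **`archSection χ₁ χ₂ a`** (+ `archSection_def`).
HONEST LABEL: HC_CM is proved only modulo the 7 printed citations (2 remaining named inputs: hLiu418 = `stmt-HodgeConjecture-24832`, h413 = `stmt-HodgeConjecture-24833`) until
rung 0 closes; REL ≠ ★ ≠ BUILT; definitions pay nothing; (V)(i) stays OPEN until 3a–3c land; count-neutral.

## References
* [BorelJacquet1979] A. Borel, H. Jacquet, *Automorphic forms and automorphic representations*, Corvallis PSPM 33.1 (1979), §4.1.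
* [Rogawski1990] J. D. Rogawski, *Automorphic Representations of Unitary Groups in Three Variables* (1990), §1.9–§1.10.
* [MoeglinWaldspurger1995] C. Mœglin, J.-L. Waldspurger, *Spectral Decomposition and Eisenstein Series* (1995), I.2.17.
-/

set_option autoImplicit false
set_option linter.dupNamespace false  -- the mandated namespace `…HodgeConjecture.HodgeConjecture.R90.S8` (LEAD #1 L1) repeats the summit's segment

noncomputable section

open NumberField Topology
open Literature.NumberTheory.Automorphic Literature.NumberTheory.Automorphic.UnitaryGroup Literature.NumberTheory.GaloisRepresentations AdelicGroupData
open Literature.NumberTheory.Automorphic.Arthur2013.Leaves.TECR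
open Literature.NumberTheory.Automorphic.UnitaryGroup.AdelicCharactersDetQuasiSplit (antidiagonal_over_det_ne_zero)

namespace Summit.HodgeConjecture.HodgeConjecture.R90.S8

variable (L : Type) [Field L] [NumberField L] [IsCMField L]

/-! ## D1 The unit phase `⟨(c•X)·X⁻¹⟩ ∈ U(1)(𝔸_{L⁺})` of an idele `X ∈ 𝔸_Lˣ` -/

/-- **`(c•X)·X⁻¹ ∈ U(1)(𝔸_{L⁺})`** for every idele `X` (`c•((c•X)X⁻¹)·((c•X)X⁻¹) = X·(c•X)⁻¹·(c•X)·X⁻¹ = 1`, ★ `conjAdele_conjAdele`). [cite: Rogawski1990, §1.9] -/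
theorem units_map_conjAdele_mul_inv_mem_adelicOne (X : (AdeleRing (𝓞 L) L)ˣ) :
    Units.map (conjAdele (↥(maximalRealSubfield L)) L (IsCMField.complexConj L) : AdeleRing (𝓞 L) L →* AdeleRing (𝓞 L) L) X * X⁻¹ ∈
      adelicOne (↥(maximalRealSubfield L)) L (IsCMField.complexConj L) := by
  rw [mem_adelicOne_iff, Units.val_mul, Units.coe_map, MonoidHom.coe_coe, map_mul, conjAdele_conjAdele (show IsCMField.complexConj L * IsCMField.complexConj L = 1 by rw [← pow_two, ← IsCMField.orderOf_complexConj L, pow_orderOf_eq_one])]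
  have h : conjAdele (↥(maximalRealSubfield L)) L (IsCMField.complexConj L) ((X⁻¹ : (AdeleRing (𝓞 L) L)ˣ) : AdeleRing (𝓞 L) L) *
      conjAdele (↥(maximalRealSubfield L)) L (IsCMField.complexConj L) (X : AdeleRing (𝓞 L) L) = 1 := by
    rw [← map_mul, Units.inv_mul, map_one]
  calc (X : AdeleRing (𝓞 L) L) * conjAdele (↥(maximalRealSubfield L)) L (IsCMField.complexConj L) ((X⁻¹ : (AdeleRing (𝓞 L) L)ˣ) : AdeleRing (𝓞 L) L) *
        (conjAdele (↥(maximalRealSubfield L)) L (IsCMField.complexConj L) (X : AdeleRing (𝓞 L) L) * ((X⁻¹ : (AdeleRing (𝓞 L) L)ˣ) : AdeleRing (𝓞 L) L))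
      = (X : AdeleRing (𝓞 L) L) * ((X⁻¹ : (AdeleRing (𝓞 L) L)ˣ) : AdeleRing (𝓞 L) L) *
          (conjAdele (↥(maximalRealSubfield L)) L (IsCMField.complexConj L) ((X⁻¹ : (AdeleRing (𝓞 L) L)ˣ) : AdeleRing (𝓞 L) L) *
            conjAdele (↥(maximalRealSubfield L)) L (IsCMField.complexConj L) (X : AdeleRing (𝓞 L) L)) := by ring
    _ = 1 := by rw [h, mul_one, Units.mul_inv]

/-- **D1 — the UNIT PHASE `⟨(c•X)·X⁻¹⟩ ∈ U(1)(𝔸_{L⁺})`** of an idele `X ∈ 𝔸_Lˣ` (at a complex place: `X̄_w∕X_w = e^{−2i arg X_w}`). [cite: Rogawski1990, §1.9] -/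
def idelePhase (X : (AdeleRing (𝓞 L) L)ˣ) : ↥(adelicOne (↥(maximalRealSubfield L)) L (IsCMField.complexConj L)) :=
  ⟨Units.map (conjAdele (↥(maximalRealSubfield L)) L (IsCMField.complexConj L) : AdeleRing (𝓞 L) L →* AdeleRing (𝓞 L) L) X * X⁻¹, units_map_conjAdele_mul_inv_mem_adelicOne L X⟩

/-- Read-back: the idele of `idelePhase X` is `(c•X)·X⁻¹` (`rfl`). [cite: Rogawski1990, §1.9] -/
@[simp] theorem coe_idelePhase (X : (AdeleRing (𝓞 L) L)ˣ) :
    ((idelePhase L X : ↥(adelicOne (↥(maximalRealSubfield L)) L (IsCMField.complexConj L))) : (AdeleRing (𝓞 L) L)ˣ) =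
      Units.map (conjAdele (↥(maximalRealSubfield L)) L (IsCMField.complexConj L) : AdeleRing (𝓞 L) L →* AdeleRing (𝓞 L) L) X * X⁻¹ := rfl

/-! ## D2 The last-row character `Θ(x) = χ₁((c•x)⁻¹)·χ₂⟨(c•x)x⁻¹⟩` -/

open Classical in
/-- **D2 — THE LAST-ROW CHARACTER `Θ`**: for `x ∈ 𝔸_L`, `Θ(x) := χ₁((c•x)⁻¹) · χ₂⟨(c•x)·x⁻¹⟩` if `x` is a unit and `0` otherwise (`χ₂` read on `U(1)(𝔸_{L⁺})` through ★ `adelicOneChar`).  On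
units it is the character `λ ↦ χ₁(λ̄⁻¹)χ₂(λ̄∕λ)` of the census; `Θ(b₂₂ x) = χ₁(b₀₀)·χ₂⟨(b₀₀b₂₂)⁻¹⟩·Θ(x)` for upper-triangular unitary `b` (file 3a). [cite: Rogawski1990, §1.10] [cite: MoeglinWaldspurger1995, I.2.17] -/
def lastRowChar (χ₁ : HeckeCharacter L) (χ₂ : ↥(TorusDict.torus (IsCMField.complexConj L)) →ₜ* ℂˣ) (x : AdeleRing (𝓞 L) L) : ℂ :=
  if hx : IsUnit x then
    ((χ₁ (Units.map (conjAdele (↥(maximalRealSubfield L)) L (IsCMField.complexConj L) : AdeleRing (𝓞 L) L →* AdeleRing (𝓞 L) L) hx.unit)⁻¹ : ℂˣ) : ℂ) *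
      ((adelicOneChar (↥(maximalRealSubfield L)) L (IsCMField.complexConj L) χ₂ (idelePhase L hx.unit) : ℂˣ) : ℂ)
  else 0

/-- Read-back on units. [cite: Rogawski1990, §1.10] -/
theorem lastRowChar_of_isUnit (χ₁ : HeckeCharacter L) (χ₂ : ↥(TorusDict.torus (IsCMField.complexConj L)) →ₜ* ℂˣ) {x : AdeleRing (𝓞 L) L} (hx : IsUnit x) :
    lastRowChar L χ₁ χ₂ x =
      ((χ₁ (Units.map (conjAdele (↥(maximalRealSubfield L)) L (IsCMField.complexConj L) : AdeleRing (𝓞 L) L →* AdeleRing (𝓞 L) L) hx.unit)⁻¹ : ℂˣ) : ℂ) *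
        ((adelicOneChar (↥(maximalRealSubfield L)) L (IsCMField.complexConj L) χ₂ (idelePhase L hx.unit) : ℂˣ) : ℂ) := by
  rw [lastRowChar, dif_pos hx]

/-- Read-back off units. [folklore] -/
theorem lastRowChar_of_not_isUnit (χ₁ : HeckeCharacter L) (χ₂ : ↥(TorusDict.torus (IsCMField.complexConj L)) →ₜ* ℂˣ) {x : AdeleRing (𝓞 L) L} (hx : ¬ IsUnit x) :
    lastRowChar L χ₁ χ₂ x = 0 := by
  rw [lastRowChar, dif_neg hx]

/-! ## D3–D5 The last row of `ι_∞(a)`, the real vanishing factor `ρ`, and the archimedean section `Φa` -/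

/-- **D3 — the LAST ROW `x_j := (ι_∞ a)₂ⱼ ∈ 𝔸_L`** of the adelic matrix of `a ∈ G_∞` (finite part `δ₂ⱼ`). [cite: BorelJacquet1979, §4.1] -/
def archLastRow (a : arch (↥(maximalRealSubfield L)) L (IsCMField.complexConj L) 3 ((StdForm.antidiagonal 3).over L)) (j : Fin 3) : AdeleRing (𝓞 L) L :=
  ((adelicVal (↥(maximalRealSubfield L)) L (IsCMField.complexConj L) 3 ((StdForm.antidiagonal 3).over L)
      (archToAdelic (↥(maximalRealSubfield L)) L (IsCMField.complexConj L) 3 ((StdForm.antidiagonal 3).over L) a) : GL (Fin 3) (AdeleRing (𝓞 L) L)) :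
    Matrix (Fin 3) (Fin 3) (AdeleRing (𝓞 L) L)) 2 j

/-- Read-back (`rfl`). [cite: BorelJacquet1979, §4.1] -/
theorem archLastRow_def (a : arch (↥(maximalRealSubfield L)) L (IsCMField.complexConj L) 3 ((StdForm.antidiagonal 3).over L)) (j : Fin 3) :
    archLastRow L a j = ((adelicVal (↥(maximalRealSubfield L)) L (IsCMField.complexConj L) 3 ((StdForm.antidiagonal 3).over L)
      (archToAdelic (↥(maximalRealSubfield L)) L (IsCMField.complexConj L) 3 ((StdForm.antidiagonal 3).over L) a) : GL (Fin 3) (AdeleRing (𝓞 L) L)) :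
        Matrix (Fin 3) (Fin 3) (AdeleRing (𝓞 L) L)) 2 j := rfl

/-- **D4 — the REAL VANISHING FACTOR `ρ(a) := ∏_{w ∣ ∞} ‖(x₂)_w‖ ∕ ‖((x₀)_w, (x₁)_w, (x₂)_w)‖_∞ ∈ [0, 1]`** (norms of the completions `L_w`; `ρ(a) = 0` iff some archimedean component of
`x₂` vanishes — exactly where `x₂` fails to be a unit). [cite: BorelJacquet1979, §4.1] -/
def archRowFactor (a : arch (↥(maximalRealSubfield L)) L (IsCMField.complexConj L) 3 ((StdForm.antidiagonal 3).over L)) : ℝ :=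
  ∏ w : InfinitePlace L, ‖(archLastRow L a 2).1 w‖ / ‖fun j : Fin 3 => (archLastRow L a j).1 w‖

/-- Read-back (`rfl`). [cite: BorelJacquet1979, §4.1] -/
theorem archRowFactor_def (a : arch (↥(maximalRealSubfield L)) L (IsCMField.complexConj L) 3 ((StdForm.antidiagonal 3).over L)) :
    archRowFactor L a = ∏ w : InfinitePlace L, ‖(archLastRow L a 2).1 w‖ / ‖fun j : Fin 3 => (archLastRow L a j).1 w‖ := rfl

/-- **D5 — THE ARCHIMEDEAN LAST-ROW SECTION `Φa(a) := Θ(x₂) · ρ(a) · χ₂⟨det ι_∞(a)⟩`** on `G_∞ = U(J₃)(L ⊗ ℝ)` (★ `adelicDet` reads `det` in `U(1)(𝔸)`): left-`(χ₁,χ₂)`-equivariant with the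
archimedean multiplier, continuous, `Φa(1) = 1` (files 3a–3c) — the letters `hΦa*` of ★ p863433. [cite: BorelJacquet1979, §4.1] [cite: Rogawski1990, §1.10] [cite: MoeglinWaldspurger1995, I.2.17] -/
def archSection (χ₁ : HeckeCharacter L) (χ₂ : ↥(TorusDict.torus (IsCMField.complexConj L)) →ₜ* ℂˣ)
    (a : arch (↥(maximalRealSubfield L)) L (IsCMField.complexConj L) 3 ((StdForm.antidiagonal 3).over L)) : ℂ :=
  lastRowChar L χ₁ χ₂ (archLastRow L a 2) * (archRowFactor L a : ℂ) *
    ((adelicOneChar (↥(maximalRealSubfield L)) L (IsCMField.complexConj L) χ₂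
      (adelicDet (↥(maximalRealSubfield L)) L (IsCMField.complexConj L) 3 ((StdForm.antidiagonal 3).over L) (antidiagonal_over_det_ne_zero L 3)
        (archToAdelic (↥(maximalRealSubfield L)) L (IsCMField.complexConj L) 3 ((StdForm.antidiagonal 3).over L) a)) : ℂˣ) : ℂ)

/-- Read-back (`rfl`). [cite: BorelJacquet1979, §4.1] -/
theorem archSection_def (χ₁ : HeckeCharacter L) (χ₂ : ↥(TorusDict.torus (IsCMField.complexConj L)) →ₜ* ℂˣ)
    (a : arch (↥(maximalRealSubfield L)) L (IsCMField.complexConj L) 3 ((StdForm.antidiagonal 3).over L)) :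
    archSection L χ₁ χ₂ a = lastRowChar L χ₁ χ₂ (archLastRow L a 2) * (archRowFactor L a : ℂ) *
      ((adelicOneChar (↥(maximalRealSubfield L)) L (IsCMField.complexConj L) χ₂
        (adelicDet (↥(maximalRealSubfield L)) L (IsCMField.complexConj L) 3 ((StdForm.antidiagonal 3).over L) (antidiagonal_over_det_ne_zero L 3)
          (archToAdelic (↥(maximalRealSubfield L)) L (IsCMField.complexConj L) 3 ((StdForm.antidiagonal 3).over L) a)) : ℂˣ) : ℂ) := rfl

/-! ## ED.2 — the `V₋` last-row functional `ℓ := x₂ − x₀`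

Second edition of D4–D5 with the last-row ENTRY `x₂` replaced by the last-row FUNCTIONAL `ℓ(a) := x₂ − x₀` (the `V₋`-coordinate of the K2E1-p13 ∕ R90-CS-p03 arch dictionary,
up to the sign `x₀ − x₂ = −ℓ`, which changes the section by the non-zero constant `Θ(−1)`; with `ℓ = x₂ − x₀` one has `ℓ(1) = 1` and `Φa(1) = 1` on the nose).  Since the WHOLE last
row scales by `b₂₂` under a left Borel translation, every algebraic identity of file 3a applies verbatim to `ℓ`. -/

/-- **D6 — the last-row functional `ℓ(a) := (ι_∞ a)₂₂ − (ι_∞ a)₂₀ ∈ 𝔸_L`** (finite part `1`, archimedean part `x₂ − x₀`). [cite: BorelJacquet1979, §4.1] -/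
def archLastRowL (a : arch (↥(maximalRealSubfield L)) L (IsCMField.complexConj L) 3 ((StdForm.antidiagonal 3).over L)) : AdeleRing (𝓞 L) L :=
  archLastRow L a 2 - archLastRow L a 0

/-- Read-back (`rfl`). [cite: BorelJacquet1979, §4.1] -/
theorem archLastRowL_def (a : arch (↥(maximalRealSubfield L)) L (IsCMField.complexConj L) 3 ((StdForm.antidiagonal 3).over L)) :
    archLastRowL L a = archLastRow L a 2 - archLastRow L a 0 := rfl

/-- **D7 — the real vanishing factor for `ℓ`: `ρ_ℓ(a) := ∏_{w ∣ ∞} ‖ℓ(a)_w‖ ∕ ‖((x₀)_w, (x₁)_w, (x₂)_w)‖_∞ ∈ [0, 2^{#\{w ∣ ∞\}}]`** (`= 0` iff some archimedean component of `ℓ(a)` vanishes).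
[cite: BorelJacquet1979, §4.1] -/
def archRowFactorL (a : arch (↥(maximalRealSubfield L)) L (IsCMField.complexConj L) 3 ((StdForm.antidiagonal 3).over L)) : ℝ :=
  ∏ w : InfinitePlace L, ‖(archLastRowL L a).1 w‖ / ‖fun j : Fin 3 => (archLastRow L a j).1 w‖

/-- Read-back (`rfl`). [cite: BorelJacquet1979, §4.1] -/
theorem archRowFactorL_def (a : arch (↥(maximalRealSubfield L)) L (IsCMField.complexConj L) 3 ((StdForm.antidiagonal 3).over L)) :
    archRowFactorL L a = ∏ w : InfinitePlace L, ‖(archLastRowL L a).1 w‖ / ‖fun j : Fin 3 => (archLastRow L a j).1 w‖ := rfl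

/-- **D8 — THE ARCHIMEDEAN `ℓ`-SECTION `Φa(a) := Θ(ℓ(a)) · ρ_ℓ(a) · χ₂⟨det ι_∞(a)⟩`** on `G_∞` — left-`(χ₁,χ₂)`-equivariant with the archimedean multiplier (file 3a, applied with
`y := ℓ(a)`), continuous (file 3b), `Φa(1) = 1`; the letters `hΦa*` of ★ p863433. [cite: BorelJacquet1979, §4.1] [cite: Rogawski1990, §1.10] [cite: MoeglinWaldspurger1995, I.2.17] -/
def archSectionL (χ₁ : HeckeCharacter L) (χ₂ : ↥(TorusDict.torus (IsCMField.complexConj L)) →ₜ* ℂˣ)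
    (a : arch (↥(maximalRealSubfield L)) L (IsCMField.complexConj L) 3 ((StdForm.antidiagonal 3).over L)) : ℂ :=
  lastRowChar L χ₁ χ₂ (archLastRowL L a) * (archRowFactorL L a : ℂ) *
    ((adelicOneChar (↥(maximalRealSubfield L)) L (IsCMField.complexConj L) χ₂
      (adelicDet (↥(maximalRealSubfield L)) L (IsCMField.complexConj L) 3 ((StdForm.antidiagonal 3).over L) (antidiagonal_over_det_ne_zero L 3)
        (archToAdelic (↥(maximalRealSubfield L)) L (IsCMField.complexConj L) 3 ((StdForm.antidiagonal 3).over L) a)) : ℂˣ) : ℂ)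

/-- Read-back (`rfl`). [cite: BorelJacquet1979, §4.1] -/
theorem archSectionL_def (χ₁ : HeckeCharacter L) (χ₂ : ↥(TorusDict.torus (IsCMField.complexConj L)) →ₜ* ℂˣ)
    (a : arch (↥(maximalRealSubfield L)) L (IsCMField.complexConj L) 3 ((StdForm.antidiagonal 3).over L)) :
    archSectionL L χ₁ χ₂ a = lastRowChar L χ₁ χ₂ (archLastRowL L a) * (archRowFactorL L a : ℂ) *
      ((adelicOneChar (↥(maximalRealSubfield L)) L (IsCMField.complexConj L) χ₂
        (adelicDet (↥(maximalRealSubfield L)) L (IsCMField.complexConj L) 3 ((StdForm.antidiagonal 3).over L) (antidiagonal_over_det_ne_zero L 3)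
          (archToAdelic (↥(maximalRealSubfield L)) L (IsCMField.complexConj L) 3 ((StdForm.antidiagonal 3).over L) a)) : ℂˣ) : ℂ) := rfl

/-! ## ED.3 — the EUCLIDEAN row norm (S8-R173 «ROW NORM», bytes of record)

Third edition of D7–D8: the denominator of the vanishing factor is the EUCLIDEAN norm `√(∑ⱼ ‖(x_j)_w‖²)` of the archimedean row (not the sup norm of D4∕D7).  Since the last row of every
`g ∈ U(J₃)_w` is `J₃`-isotropic (`x₀x̄₂ + |x₁|² + x₂x̄₀ = 0`), `|x₂ − x₀|² = |x₀|² + |x₁|² + |x₂|²`, so `ρ_E ≡ 1` and `ℓ(x)_w ≠ 0` everywhere on `G_∞` (theorems of the 3c-E file):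
`archSectionE = Θ(ℓ)·χ₂⟨det⟩` is the pure unitary phase of record.  The factor is kept in the definition (it is `1` on `G_∞`, harmless, and keeps D8′ total and of the same shape as D5∕D8). -/

/-- **D7′ — the Euclidean vanishing factor `ρ_E(a) := ∏_{w ∣ ∞} ‖ℓ(a)_w‖ ∕ √(∑ⱼ ‖(x_j)_w‖²)`** (`= 1` on `G_∞` by `J₃`-isotropy of the last row — file 3c-E). [cite: BorelJacquet1979, §4.1] -/
def archRowFactorE (a : arch (↥(maximalRealSubfield L)) L (IsCMField.complexConj L) 3 ((StdForm.antidiagonal 3).over L)) : ℝ :=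
  ∏ w : InfinitePlace L, ‖(archLastRowL L a).1 w‖ / Real.sqrt (∑ j : Fin 3, ‖(archLastRow L a j).1 w‖ ^ 2)

/-- Read-back (`rfl`). [cite: BorelJacquet1979, §4.1] -/
theorem archRowFactorE_def (a : arch (↥(maximalRealSubfield L)) L (IsCMField.complexConj L) 3 ((StdForm.antidiagonal 3).over L)) :
    archRowFactorE L a = ∏ w : InfinitePlace L, ‖(archLastRowL L a).1 w‖ / Real.sqrt (∑ j : Fin 3, ‖(archLastRow L a j).1 w‖ ^ 2) := rfl

/-- **D8′ — THE ARCHIMEDEAN SECTION OF RECORD `Φa(a) := Θ(ℓ(a)) · ρ_E(a) · χ₂⟨det ι_∞(a)⟩`** on `G_∞` (`ρ_E ≡ 1` there, so `Φa = Θ(ℓ)·χ₂⟨det⟩`, a pure unitary phase): left-`(χ₁,χ₂)`-equivariant,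
continuous (composition of continuous maps — `ℓ(a)` is always a unit), `Φa(1) = 1`; the letters `hΦa*` of ★ p863433 and the section p13's identification and CS-p03's (a-10b) cores see.
[cite: BorelJacquet1979, §4.1] [cite: Rogawski1990, §1.10] [cite: MoeglinWaldspurger1995, I.2.17] -/
def archSectionE (χ₁ : HeckeCharacter L) (χ₂ : ↥(TorusDict.torus (IsCMField.complexConj L)) →ₜ* ℂˣ)
    (a : arch (↥(maximalRealSubfield L)) L (IsCMField.complexConj L) 3 ((StdForm.antidiagonal 3).over L)) : ℂ :=
  lastRowChar L χ₁ χ₂ (archLastRowL L a) * (archRowFactorE L a : ℂ) *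
    ((adelicOneChar (↥(maximalRealSubfield L)) L (IsCMField.complexConj L) χ₂
      (adelicDet (↥(maximalRealSubfield L)) L (IsCMField.complexConj L) 3 ((StdForm.antidiagonal 3).over L) (antidiagonal_over_det_ne_zero L 3)
        (archToAdelic (↥(maximalRealSubfield L)) L (IsCMField.complexConj L) 3 ((StdForm.antidiagonal 3).over L) a)) : ℂˣ) : ℂ)

/-- Read-back (`rfl`). [cite: BorelJacquet1979, §4.1] -/
theorem archSectionE_def (χ₁ : HeckeCharacter L) (χ₂ : ↥(TorusDict.torus (IsCMField.complexConj L)) →ₜ* ℂˣ)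
    (a : arch (↥(maximalRealSubfield L)) L (IsCMField.complexConj L) 3 ((StdForm.antidiagonal 3).over L)) :
    archSectionE L χ₁ χ₂ a = lastRowChar L χ₁ χ₂ (archLastRowL L a) * (archRowFactorE L a : ℂ) *
      ((adelicOneChar (↥(maximalRealSubfield L)) L (IsCMField.complexConj L) χ₂
        (adelicDet (↥(maximalRealSubfield L)) L (IsCMField.complexConj L) 3 ((StdForm.antidiagonal 3).over L) (antidiagonal_over_det_ne_zero L 3)
          (archToAdelic (↥(maximalRealSubfield L)) L (IsCMField.complexConj L) 3 ((StdForm.antidiagonal 3).over L) a)) : ℂˣ) : ℂ) := rfl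

/-! ## ED.4 — THE LEVEL OF RECORD `K′ = ι(K_∞)·ι_f(K_f)` and its right character `ω = Φa ∘ (·)_∞` (S8-R181)

The section of record `φ(g) = Φa(g_∞)·Φf(g_f)` is right-equivariant under the FULL archimedean maximal compact `K_∞` (by `J₃`-centro-symmetry of `K_∞`, `ℓ(a·k) = ℓ(a)·ℓ(k)`, so
`Φa(a·k) = Φa(a)·Φa(k)` — file 3d) and right-invariant under the finite level `K_f`: its level is `K′ := {k ∈ K | k_f ∈ K_f} = ι(K_∞)·ι_f(K_f)` with `ω(k) := Φa(k_∞)` (`= 1` on `ι_f(K_f)`). -/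

/-- **D9 — THE LEVEL OF RECORD `K′(K_f) := {k ∈ K = K_∞·G(𝒪̂) | k_f ∈ K_f} ≤ G(𝔸)`** (for `K_f ≤ G(𝒪̂)_f` this is `ι(K_∞)·ι_f(K_f)`; ★ `standardMaximalCompactGL`, ★ `finPart`). [cite: BorelJacquet1979, §4.1]
[cite: MoeglinWaldspurger1995, I.2.17] -/
def levelOfRecord (Kf : Subgroup ↥(finAdelic (↥(maximalRealSubfield L)) L (IsCMField.complexConj L) 3 ((StdForm.antidiagonal 3).over L))) :
    Subgroup (quasiSplit (↥(maximalRealSubfield L)) L (IsCMField.complexConj L) 3).Adelic :=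
  ((standardMaximalCompactGL 3 L).comap (adelicVal (↥(maximalRealSubfield L)) L (IsCMField.complexConj L) 3 ((StdForm.antidiagonal 3).over L)) :
      Subgroup (quasiSplit (↥(maximalRealSubfield L)) L (IsCMField.complexConj L) 3).Adelic) ⊓
    Kf.comap (finPart (↥(maximalRealSubfield L)) L (IsCMField.complexConj L) 3 ((StdForm.antidiagonal 3).over L))

/-- Membership in the level of record (definitional): `k ∈ K` and `k_f ∈ K_f`. [cite: BorelJacquet1979, §4.1] -/
theorem mem_levelOfRecord_iff (Kf : Subgroup ↥(finAdelic (↥(maximalRealSubfield L)) L (IsCMField.complexConj L) 3 ((StdForm.antidiagonal 3).over L)))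
    (k : (quasiSplit (↥(maximalRealSubfield L)) L (IsCMField.complexConj L) 3).Adelic) :
    k ∈ levelOfRecord L Kf ↔
      adelicVal (↥(maximalRealSubfield L)) L (IsCMField.complexConj L) 3 ((StdForm.antidiagonal 3).over L) k ∈ standardMaximalCompactGL 3 L ∧
        finPart (↥(maximalRealSubfield L)) L (IsCMField.complexConj L) 3 ((StdForm.antidiagonal 3).over L) k ∈ Kf :=
  Iff.rfl

/-- **D10 — THE RIGHT CHARACTER OF RECORD `ω(k) := Φa(k_∞)`** on the level of record (`Φa = archSectionE χ₁ χ₂`; a character of `K_∞` by file 3d, `= 1` on `ι_f(K_f)`). [cite: BorelJacquet1979, §4.1]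
[cite: MoeglinWaldspurger1995, I.2.17] -/
def omegaOfRecord (χ₁ : HeckeCharacter L) (χ₂ : ↥(TorusDict.torus (IsCMField.complexConj L)) →ₜ* ℂˣ)
    (Kf : Subgroup ↥(finAdelic (↥(maximalRealSubfield L)) L (IsCMField.complexConj L) 3 ((StdForm.antidiagonal 3).over L))) : ↥(levelOfRecord L Kf) → ℂ :=
  fun k => archSectionE L χ₁ χ₂ (archPart (↥(maximalRealSubfield L)) L (IsCMField.complexConj L) 3 ((StdForm.antidiagonal 3).over L)
    (k : (quasiSplit (↥(maximalRealSubfield L)) L (IsCMField.complexConj L) 3).Adelic))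

/-- Read-back (`rfl`). [cite: BorelJacquet1979, §4.1] -/
theorem omegaOfRecord_apply (χ₁ : HeckeCharacter L) (χ₂ : ↥(TorusDict.torus (IsCMField.complexConj L)) →ₜ* ℂˣ)
    (Kf : Subgroup ↥(finAdelic (↥(maximalRealSubfield L)) L (IsCMField.complexConj L) 3 ((StdForm.antidiagonal 3).over L))) (k : ↥(levelOfRecord L Kf)) :
    omegaOfRecord L χ₁ χ₂ Kf k = archSectionE L χ₁ χ₂ (archPart (↥(maximalRealSubfield L)) L (IsCMField.complexConj L) 3 ((StdForm.antidiagonal 3).over L)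
      (k : (quasiSplit (↥(maximalRealSubfield L)) L (IsCMField.complexConj L) 3).Adelic)) := rfl

end Summit.HodgeConjecture.HodgeConjecture.R90.S8

end
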